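import Summits.AtomisticToContinuum.HydrodynamicLimit.Theorems.JaynesSqueezeLocalGibbsConcentrationDiluteIdentification
import Summits.AtomisticToContinuum.HydrodynamicLimit.Theorems.JaynesSqueezeLocalGibbsConcentrationDiluteFreeEnergy
import Summits.AtomisticToContinuum.HydrodynamicLimit.Theorems.JaynesSqueezeLocalGibbsConcentrationDiluteConditional

/-!
# `LocalGibbsConcentrationDilute` (route `JaynesSqueeze`, item stmt-AtomisticToContinuum-13460): the mean-density LDA and the proof

Closing file of item `LocalGibbsConcentrationDilute` (stmt-AtomisticToContinuum-13460) of route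
`JaynesSqueeze`. The exponential law of large numbers for dilute local Gibbs states of hard spheres
on `𝕋³` (packing-only smallness `ρ₁σ³ ≤ η₁`) holds UNCONDITIONALLY
(`localGibbsConcentrationDilute_proof`, at the end; the item's hypothesis `HsEosLowDensity` is
not even needed): the conditional reduction `localGibbsConcentrationDilute_of_meanLDA`
(`…DiluteConditional`: tilted activities + Jensen for the positions, Chernoff bounds with Fernique
moments for the conditionally Gaussian velocities) is fed with the unconditional mean-density
local-density approximation `meanLDA` proved here from the tree's canonical cluster expansion
(`HardSphereEulerRatio/LLN`) through `qN_uniform`, `hsExcessFreeEnergy_eq_integral`, Widom's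
identity `exists_excessChemicalPotential_eq_log_ratioLimit` (proved here first: by the
substitution `u = σ³ s`, `η f_ex(η) = ∫₀^η log R(u^{1/3}) du`, then the fundamental theorem of
calculus gives `f_ex(η) + η f_ex'(η) = log R(η^{1/3})`) and `rhoLim_profileOf_eq`.

The mean-density LDA (`meanLDA`): for every `σ > 0`, `c > 0`, every
continuous normalised density `ρ` with `c ≤ ρ`, `ρσ³ ≤ η₁'` and every continuous `f`, the mean
empirical density field of the configurational Gibbs measure with the route's activity
`a = ρ e^{g_σ(ρ)}` tends to `∫ f ρ` (`meanLDA`):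

* by Widom's identity (`exists_excessChemicalPotential_eq_log_ratioLimit`) `a = ρ R(σρ^{1/3})`;
* the profile `β = a/∫a` satisfies the smallness conditions of the cluster expansion when
  `sup ρ σ³` is small (`smallDensity_of_ovDensity_le`, packing-only smallness);
* the mean empirical density is the one-point expectation `onePt β σ f N 0` of the tree
  (`integral_sum_posGibbsMeasure`), which tends to `Ilim β σ f = ∫ f · rhoLim β σ`
  (`SmallDensity.tendsto_onePt`, `SmallDensity.Ilim_eq_integral`), and `rhoLim β σ = ρ`
  (`rhoLim_profileOf_eq`).

No definitions (pure-proof helper file). prover-pitem-stmt-AtomisticToContinuum-13460-0.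
-/

noncomputable section

namespace Summit.AtomisticToContinuum.HydrodynamicLimit.Theorems

open MeasureTheory Filter Topology Set Finset
open Literature.Analysis.FluidPDE Literature.MathematicalPhysics.KineticTheory
open Literature.MathematicalPhysics.StatisticalMechanics Literature.Probability.LatticeModels
open scoped ENNReal

namespace LocalGibbsConcentration

section ChemicalPotential

/-- **The excess chemical potential is the log insertion ratio** (Widom's formula for the
canonical hard-sphere gas on `𝕋³` at low density): there is `σ₀ > 0` such that the smallness
conditions hold for all `0 < s < σ₀` and, for all `0 < η < σ₀³`,
`f_ex(η) + η f_ex'(η) = log R(η^{1/3})` with `f_ex = hsExcessFreeEnergy` and `R` the limit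
insertion ratio `ratioLimit uniformProfile`. [folklore] -/
theorem exists_excessChemicalPotential_eq_log_ratioLimit :
    ∃ σ₀ : ℝ, 0 < σ₀ ∧ (∀ s : ℝ, 0 < s → s < σ₀ → SmallDensity uniformProfile s) ∧
      ∀ η : ℝ, 0 < η → η < σ₀ ^ 3 →
        hsExcessFreeEnergy η + η * deriv hsExcessFreeEnergy η =
          Real.log (ratioLimit uniformProfile (η ^ (1 / 3 : ℝ))) := by
  obtain ⟨σ₀, hσ₀, hsd0⟩ := exists_smallDensity uniformProfile one_pos
  have hsd : ∀ s : ℝ, 0 < s → s < σ₀ → SmallDensity uniformProfile s := fun s h0 h1 => (hsd0 s h0 h1).1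
  refine ⟨σ₀, hσ₀, hsd, ?_⟩
  -- the log insertion ratio as a function of the packing `u`
  set Lf : ℝ → ℝ := fun u => Real.log (ratioLimit uniformProfile (u ^ (1 / 3 : ℝ))) with hLf
  -- cube roots land in the smallness interval
  have hroot : ∀ u : ℝ, 0 < u → u < σ₀ ^ 3 → 0 < u ^ (1 / 3 : ℝ) ∧ u ^ (1 / 3 : ℝ) < σ₀ := by
    intro u hu0 hu1
    refine ⟨Real.rpow_pos_of_pos hu0 _, ?_⟩
    calc u ^ (1 / 3 : ℝ) < (σ₀ ^ 3) ^ (1 / 3 : ℝ) :=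
          Real.rpow_lt_rpow hu0.le hu1 (by norm_num)
      _ = σ₀ := pow_three_rpow_third hσ₀.le
  -- `Lf` is continuous on `(0, σ₀³)` and bounded by `log 2`
  have hcontAt : ∀ u : ℝ, 0 < u → u < σ₀ ^ 3 → ContinuousAt Lf u := by
    intro u hu0 hu1
    have hr := hroot u hu0 hu1
    have hR : ContinuousAt (fun s => ratioLimit uniformProfile s) (u ^ (1 / 3 : ℝ)) :=
      continuousAt_ratioLimit hsd hr.1 hr.2
    have hcube : ContinuousAt (fun v : ℝ => v ^ (1 / 3 : ℝ)) u :=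
      Real.continuousAt_rpow_const u (1 / 3) (Or.inl hu0.ne')
    have hcomp : ContinuousAt (fun v : ℝ => ratioLimit uniformProfile (v ^ (1 / 3 : ℝ))) u :=
      ContinuousAt.comp (g := fun s => ratioLimit uniformProfile s) hR hcube
    have hsm := hsd _ hr.1 hr.2
    have hpos : 0 < ratioLimit uniformProfile (u ^ (1 / 3 : ℝ)) := hsm.ratioLimit_pos
    exact ContinuousAt.comp (g := Real.log) (Real.continuousAt_log hpos.ne') hcomp
  have hcontOn : ContinuousOn Lf (Ioo 0 (σ₀ ^ 3)) := fun u hu =>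
    (hcontAt u hu.1 hu.2).continuousWithinAt
  have hbound : ∀ u : ℝ, 0 < u → u < σ₀ ^ 3 → |Lf u| ≤ Real.log 2 := by
    intro u hu0 hu1
    have hr := hroot u hu0 hu1
    have hsm := hsd _ hr.1 hr.2
    have hR := hsm.ratioLimit_mem
    rw [hLf]; dsimp only
    rw [abs_le]
    constructor
    · rw [← Real.log_inv]
      exact Real.log_le_log (by norm_num) (by rw [inv_eq_one_div]; exact hR.1)
    · exact Real.log_le_log (by linarith [hR.1]) hR.2
  have hii : ∀ a b : ℝ, 0 ≤ a → a ≤ b → b < σ₀ ^ 3 → IntervalIntegrable Lf volume a b := by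
    intro a b ha hab hb
    rw [intervalIntegrable_iff_integrableOn_Ioc_of_le hab]
    have hsub : Ioc a b ⊆ Ioo (0 : ℝ) (σ₀ ^ 3) := fun s hs => ⟨ha.trans_lt hs.1, hs.2.trans_lt hb⟩
    haveI : IsFiniteMeasure ((volume : Measure ℝ).restrict (Ioc a b)) :=
      ⟨by rw [Measure.restrict_apply_univ]; exact measure_Ioc_lt_top⟩
    refine (integrable_const (Real.log 2)).mono'
      ((hcontOn.mono hsub).aestronglyMeasurable measurableSet_Ioc) ?_
    exact (ae_restrict_iff' measurableSet_Ioc).2 (Eventually.of_forall fun s hs => by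
      rw [Real.norm_eq_abs]; exact hbound s (hsub hs).1 (hsub hs).2)
  -- the free energy formula in the packing variable: `f_ex(η) = η⁻¹ ∫₀^η Lf`
  have hformula : ∀ η : ℝ, 0 < η → η < σ₀ ^ 3 →
      hsExcessFreeEnergy η = η⁻¹ * ∫ u in (0 : ℝ)..η, Lf u := by
    intro η hη0 hη1
    have hr := hroot η hη0 hη1
    have hsm := hsd _ hr.1 hr.2
    have h1 := hsExcessFreeEnergy_eq_integral hsm
    rw [rpow_third_pow_three hη0.le] at h1
    rw [h1]
    -- use the substitution on `[0, 1]` only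
    have hcongr : ∫ s in (0 : ℝ)..1, Real.log (ratioLimit uniformProfile (η ^ (1 / 3 : ℝ) * s ^ (1 / 3 : ℝ))) =
        ∫ s in (0 : ℝ)..1, Lf (η * s) := by
      refine intervalIntegral.integral_congr fun s hs => ?_
      rw [Set.uIcc_of_le zero_le_one] at hs
      rw [hLf]; dsimp only
      rw [Real.mul_rpow hη0.le hs.1]
    rw [hcongr, intervalIntegral.integral_comp_mul_left Lf hη0.ne', mul_zero, mul_one, smul_eq_mul]
  -- the fundamental theorem of calculus
  intro η hη0 hη1
  set Φ : ℝ → ℝ := fun v => ∫ u in (0 : ℝ)..v, Lf u with hΦ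
  have hΦ' : HasDerivAt Φ (Lf η) η :=
    intervalIntegral.integral_hasDerivAt_right (hii 0 η le_rfl hη0.le hη1)
      (hcontOn.stronglyMeasurableAtFilter isOpen_Ioo η ⟨hη0, hη1⟩) (hcontAt η hη0 hη1)
  have hinv : HasDerivAt (fun v : ℝ => v⁻¹) (-(η ^ 2)⁻¹) η := hasDerivAt_inv hη0.ne'
  have hprod : HasDerivAt (fun v : ℝ => v⁻¹ * Φ v) (-(η ^ 2)⁻¹ * Φ η + η⁻¹ * Lf η) η :=
    hinv.mul hΦ'
  -- `f_ex` agrees with `v⁻¹ Φ v` near `η`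
  have hev : hsExcessFreeEnergy =ᶠ[𝓝 η] fun v => v⁻¹ * Φ v := by
    filter_upwards [Ioo_mem_nhds hη0 hη1] with v hv
    exact hformula v hv.1 hv.2
  have hderiv : HasDerivAt hsExcessFreeEnergy (-(η ^ 2)⁻¹ * Φ η + η⁻¹ * Lf η) η :=
    hprod.congr_of_eventuallyEq hev
  rw [hderiv.deriv, hformula η hη0 hη1]
  field_simp
  ring

end ChemicalPotential

section SmallDensityNumerics

/-- **Packing-only smallness**: `0 < σ < 1/2` and `λ = M v₁ σ³ ≤ 1/100` imply all the smallness
conditions of the cluster expansion (`θ = 2eλ ≤ 0.0544`, `eθ/(1-θ) < 0.16`, `4eθ/(1-θ)² < 0.67`).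
[folklore] -/
theorem smallDensity_of_ovDensity_le {P : DensityProfile} {σ : ℝ} (hσ : 0 < σ) (hσ2 : σ < 1 / 2)
    (hl : ovDensity P σ ≤ 1 / 100) : SmallDensity P σ := by
  have he := Real.exp_one_lt_d9
  have he0 := Real.exp_pos 1
  have hl0 : 0 ≤ ovDensity P σ := ovDensity_nonneg hσ.le
  set θ := geomRatio P σ with hθ
  have hθ0 : 0 ≤ θ := geomRatio_nonneg hσ.le
  have hθle : θ ≤ 544 / 10000 := by
    rw [hθ, geomRatio]; nlinarith
  have hθ1 : θ < 1 := by linarith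
  have heθ : Real.exp 1 * θ ≤ 148 / 1000 := by nlinarith
  refine ⟨hσ, hσ2, by linarith, hθ1, ?_, ?_⟩
  · rw [div_lt_iff₀ (by linarith)]; nlinarith
  · rw [contractionC, ← hθ]
    have hden : (894 : ℝ) / 1000 ≤ (1 - θ) ^ 2 := by nlinarith
    rw [show 4 * (Real.exp 1 * θ / (1 - θ) ^ 2) = 4 * (Real.exp 1 * θ) / (1 - θ) ^ 2 by ring,
      div_lt_iff₀ (by nlinarith)]
    nlinarith

/-- The supremum of a profile is bounded by any pointwise bound. [folklore] -/
theorem DensityProfile_M_le (P : DensityProfile) {B : ℝ} (hB : ∀ y, P.β y ≤ B) : P.M ≤ B :=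
  csSup_le (Set.range_nonempty _) (by rintro _ ⟨y, rfl⟩; exact hB y)

end SmallDensityNumerics

section Mean

/-- **The mean empirical density field is the one-point expectation of the tree**:
`(N+1)⁻¹ ∫ ∑ᵢ f(xᵢ) d(posGibbsMeasure a ε_N (N+1)) = onePt β σ f N 0` (`β = a/∫a`;
`posGibbsMeasure_eq`, exchangeability `integral_mul_efR_eq_Md`). [folklore] -/
theorem integral_sum_posGibbsMeasure {a : T3 → ℝ} (ha : Continuous a) (ha0 : ∀ x, 0 < a x)
    {σ : ℝ} (h : SmallDensity (profileOf a ha ha0) σ) {f : T3 → ℝ} (hf : Continuous f) (N : ℕ) :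
    ((N + 1 : ℕ) : ℝ)⁻¹ * ∫ x, ∑ i, f (x i) ∂posGibbsMeasure a (hsDiameter σ N) (N + 1) =
      onePt (profileOf a ha ha0) σ f N 0 := by
  set P := profileOf a ha ha0 with hP
  set ε := hsDiameter σ N with hε
  obtain ⟨C, -, hC⟩ := exists_forall_abs_le_of_continuous hf
  have hXi : 0 < XiN P σ N (N + 1) := XiN_pos h.σ_pos.le h.σ_lt_half h.ovDensity_lt_one le_rfl
  have hXi' : 0 < Xi P ε (N + 1) (N + 1) := by rwa [XiN] at hXi
  have hD : MeasurableSet (hardCoreSet (Ov ε) (Finset.univ : Finset (Fin (N + 1))) : Set (Fin (N + 1) → T3)) :=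
    measurableSet_hardCoreSet (measurableSet_ov ε) _
  -- the integral against the Gibbs measure as a hard-core integral
  have hF : Measurable fun x : Fin (N + 1) → T3 => ∑ i, f (x i) :=
    Finset.measurable_sum _ fun i _ => hf.measurable.comp (measurable_pi_apply i)
  rw [posGibbsMeasure_eq ha ha0, integral_smul_measure, ENNReal.toReal_ofReal (inv_nonneg.2 (Xi_nonneg _)),
    ← integral_indicator hD]
  -- indicator = efR
  have hind : (fun x : Fin (N + 1) → T3 => (hardCoreSet (Ov ε) (Finset.univ : Finset (Fin (N + 1)))).indicator
      (fun x => ∑ i, f (x i)) x) = fun x => ∑ i, f (x i) * efR (Ov ε) x Finset.univ := by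
    funext x
    rw [efR_eq_indicator, ← Finset.sum_mul]
    by_cases hx : x ∈ hardCoreSet (Ov ε) (Finset.univ : Finset (Fin (N + 1)))
    · rw [Set.indicator_of_mem hx, Set.indicator_of_mem hx, Pi.one_apply, mul_one]
    · rw [Set.indicator_of_notMem hx, Set.indicator_of_notMem hx, mul_zero]
  rw [hind, integral_finsetSum Finset.univ (f := fun i x => f (x i) * efR (Ov ε) x Finset.univ)
    (fun i _ => integrable_mul_efR P ε (F := fun x => f (x i))
      (hf.measurable.comp (measurable_pi_apply i)) (fun x => hC (x i)))]
  simp_rw [integral_mul_efR_eq_Md P ε hf.measurable]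
  rw [Finset.sum_const, Finset.card_univ, Fintype.card_fin, nsmul_eq_mul, onePt, Nat.sub_zero, XiN, smul_eq_mul]
  field_simp
  rfl

/-- **The mean-density local-density approximation (unconditional).** There is `η₁' > 0` such that
for all `σ > 0`, `c > 0`, every continuous normalised `ρ` with `c ≤ ρ`, `ρσ³ ≤ η₁'` and every
continuous `f`, the mean empirical density field of `f` under the configurational Gibbs measure
with the activity `ρ e^{g_σ(ρ)}` (`g_σ(r) = f_ex(rσ³) + rσ³ f_ex'(rσ³)`) tends to `∫ f ρ`.
[folklore] -/
theorem meanLDA :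
    ∃ η₁' : ℝ, 0 < η₁' ∧ ∀ σ : ℝ, 0 < σ → ∀ c : ℝ, 0 < c → ∀ ρ : T3 → ℝ, Continuous ρ →
      (∀ x, c ≤ ρ x ∧ ρ x * σ ^ 3 ≤ η₁') → ∫ x, ρ x = 1 → ∀ f : T3 → ℝ, Continuous f →
      Tendsto (fun N : ℕ => ((N + 1 : ℕ) : ℝ)⁻¹ * ∫ x, ∑ i, f (x i)
        ∂posGibbsMeasure (fun x => ρ x * Real.exp (hsExcessFreeEnergy (ρ x * σ ^ 3) +
          ρ x * σ ^ 3 * deriv hsExcessFreeEnergy (ρ x * σ ^ 3))) (hsDiameter σ N) (N + 1))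
        atTop (𝓝 (∫ x, f x * ρ x)) := by
  obtain ⟨σ₀, hσ₀, hsd, hW⟩ := exists_excessChemicalPotential_eq_log_ratioLimit
  have hv := v₁_pos
  set η₁' : ℝ := min (σ₀ ^ 3 / 2) (min (1 / (400 * v₁)) (1 / 16)) with hη
  have hη0 : 0 < η₁' := lt_min (by positivity) (lt_min (by positivity) (by norm_num))
  have hη1 : η₁' < σ₀ ^ 3 := lt_of_le_of_lt (min_le_left _ _) (by linarith [pow_pos hσ₀ 3])
  have hη2 : η₁' ≤ 1 / (400 * v₁) := (min_le_right _ _).trans (min_le_left _ _)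
  have hη3 : η₁' ≤ 1 / 16 := (min_le_right _ _).trans (min_le_right _ _)
  refine ⟨η₁', hη0, fun σ hσ c hc ρ hρc hband hnorm f hf => ?_⟩
  have hσ3 : 0 < σ ^ 3 := by positivity
  have hρpos : ∀ x, 0 < ρ x := fun x => hc.trans_le (hband x).1
  -- packings and cube roots
  have hpack : ∀ x, 0 < ρ x * σ ^ 3 ∧ ρ x * σ ^ 3 < σ₀ ^ 3 := fun x =>
    ⟨mul_pos (hρpos x) hσ3, (hband x).2.trans_lt hη1⟩
  have hroot : ∀ x, 0 < (ρ x * σ ^ 3) ^ (1 / 3 : ℝ) ∧ (ρ x * σ ^ 3) ^ (1 / 3 : ℝ) < σ₀ := fun x =>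
    ⟨Real.rpow_pos_of_pos (hpack x).1 _, by
      calc (ρ x * σ ^ 3) ^ (1 / 3 : ℝ) < (σ₀ ^ 3) ^ (1 / 3 : ℝ) :=
            Real.rpow_lt_rpow (hpack x).1.le (hpack x).2 (by norm_num)
        _ = σ₀ := pow_three_rpow_third hσ₀.le⟩
  have hsm : ∀ x, SmallDensity uniformProfile ((ρ x * σ ^ 3) ^ (1 / 3 : ℝ)) := fun x =>
    hsd _ (hroot x).1 (hroot x).2
  -- Widom: the activity is `ρ R`
  set a : T3 → ℝ := fun x => ρ x * Real.exp (hsExcessFreeEnergy (ρ x * σ ^ 3) +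
    ρ x * σ ^ 3 * deriv hsExcessFreeEnergy (ρ x * σ ^ 3)) with ha_def
  have hact : ∀ x, a x = ρ x * ratioLimit uniformProfile ((ρ x * σ ^ 3) ^ (1 / 3 : ℝ)) := by
    intro x
    rw [ha_def]; dsimp only
    rw [hW _ (hpack x).1 (hpack x).2, Real.exp_log (hsm x).ratioLimit_pos]
  have ha_fun : a = fun x => ρ x * ratioLimit uniformProfile ((ρ x * σ ^ 3) ^ (1 / 3 : ℝ)) := funext hact
  -- continuity and positivity of the activity
  have hRcont : ContinuousOn (fun s => ratioLimit uniformProfile s) (Ioo 0 σ₀) := fun s hs =>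
    (continuousAt_ratioLimit hsd hs.1 hs.2).continuousWithinAt
  have ha : Continuous a := by
    rw [ha_fun]
    refine hρc.mul (hRcont.comp_continuous ?_ fun x => ⟨(hroot x).1, (hroot x).2⟩)
    exact (hρc.mul continuous_const).rpow_const fun x => Or.inl (hpack x).1.ne'
  have ha0 : ∀ x, 0 < a x := fun x => by rw [hact x]; exact mul_pos (hρpos x) (hsm x).ratioLimit_pos
  -- bounds: `a ≤ A = 2 η₁'/σ³`
  set A : ℝ := 2 * η₁' / σ ^ 3 with hA_def
  have hA : ∀ x, a x ≤ A := fun x => by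
    rw [hact x, hA_def]
    have h1 : ρ x ≤ η₁' / σ ^ 3 := by rw [le_div_iff₀ hσ3]; exact (hband x).2
    calc ρ x * ratioLimit uniformProfile ((ρ x * σ ^ 3) ^ (1 / 3 : ℝ)) ≤ (η₁' / σ ^ 3) * 2 :=
          mul_le_mul h1 (hsm x).ratioLimit_mem.2 (hsm x).ratioLimit_pos.le (by positivity)
      _ = 2 * η₁' / σ ^ 3 := by ring
  have hAσ : Real.exp 1 * v₁ * σ ^ 3 * A ≤ 1 / 4 := by
    rw [hA_def]
    have he := Real.exp_one_lt_d9
    have : Real.exp 1 * v₁ * σ ^ 3 * (2 * η₁' / σ ^ 3) = 2 * Real.exp 1 * (v₁ * η₁') := by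
      field_simp
    rw [this]
    have hvη : v₁ * η₁' ≤ 1 / 400 := by
      rw [le_div_iff₀ (by positivity)] at hη2
      linarith
    nlinarith [Real.exp_pos 1]
  -- the profile and its smallness
  set P := profileOf a ha ha0 with hP
  have hσlt : σ < 1 / 2 := sigma_lt_half hσ hρc hnorm fun x => (hband x).2.trans hη3
  have hInt : 1 / 2 ≤ ∫ y, a y := by
    calc (1 / 2 : ℝ) = ∫ y, ρ y * (1 / 2) := by rw [integral_mul_const, hnorm, one_mul]
      _ ≤ ∫ y, a y := integral_mono ((integrable_of_continuous_T3 hρc).mul_const _)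
          (integrable_of_continuous_T3 ha) fun y => by
            rw [hact y]; exact mul_le_mul_of_nonneg_left (hsm y).ratioLimit_mem.1 (hρpos y).le
  have hM : P.M ≤ 2 * A := by
    refine DensityProfile_M_le P fun y => ?_
    rw [hP, profileOf_β]
    rw [div_le_iff₀ (by linarith)]
    nlinarith [hA y, (ha0 y).le]
  have hSD : SmallDensity P σ := by
    refine smallDensity_of_ovDensity_le hσ hσlt ?_
    rw [ovDensity]
    have hvη : v₁ * η₁' ≤ 1 / 400 := by
      rw [le_div_iff₀ (by positivity)] at hη2
      linarith
    calc P.M * v₁ * σ ^ 3 ≤ 2 * A * v₁ * σ ^ 3 := by gcongr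
      _ = 4 * (v₁ * η₁') := by rw [hA_def]; field_simp; ring
      _ ≤ 1 / 100 := by linarith
  -- the limit
  obtain ⟨C, -, hC⟩ := exists_forall_abs_le_of_continuous hf
  have hlim := hSD.tendsto_onePt hf.measurable hC 0
  rw [hSD.Ilim_eq_integral hf] at hlim
  have hρeq : ∀ x, rhoLim P σ x = ρ x := fun x =>
    rhoLim_profileOf_eq hσ hσlt ha ha0 hSD hρpos hnorm hsm hact hA hAσ x
  simp_rw [hρeq] at hlim
  refine hlim.congr fun N => ?_
  exact (integral_sum_posGibbsMeasure ha ha0 hSD hf N).symm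

end Mean

end LocalGibbsConcentration

open Summit.AtomisticToContinuum.HydrodynamicLimit.Theses.JaynesSqueeze in
/-- **`LocalGibbsConcentrationDilute` holds** (item stmt-AtomisticToContinuum-13460 of route
`JaynesSqueeze`): the exponential law of large numbers for the empirical density, momentum and
energy fields of dilute local Gibbs states with the LDA activity `ρ₁ e^{g_σ(ρ₁)}`, with
packing-only smallness. Unconditional. [folklore] -/
theorem localGibbsConcentrationDilute_proof : LocalGibbsConcentrationDilute :=
  LocalGibbsConcentration.localGibbsConcentrationDilute_of_meanLDA fun _ =>
    LocalGibbsConcentration.meanLDA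

end Summit.AtomisticToContinuum.HydrodynamicLimit.Theorems
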